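import Literature.ModelTheory.ExponentialFields.OMinimalOfModelComplete
import HarnessLib

/-!
# Consequences of the model completeness of `T_e` for the `e`-reducts of the models of `T_exp`

Topic `Literature/ModelTheory/ExponentialFields`.  Wilkie 1996, Theorem 11.1 (p. 1091): "`T_e` is
smooth and model complete", `T_e = Th(ℝ; +, ·, -, 0, 1, e, ≤)`, `e(x) = exp((1 + x²)⁻¹)`
(`ETheory.lean`; den Besten 2016, Definition 6.2.2).  Granting the model completeness of `T_e`
(a case of Wilkie's First Main Theorem; den Besten, Corollary 6.2.4) as the hypothesis
`eTheory.IsModelComplete`, this file derives what chapter 7 of den Besten's thesis uses about the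
`e`-reducts `K | L_e` of the models `k ⊆ K` of `T_exp`:

* `RealExpModel.isOMinimal_orderedERing_of_isModelComplete`: **every `K | L_e` is o-minimal**
  (the o-minimality half of den Besten's Theorem 7.2.1 / Corollary 4.1.7, obtained here from
  Khovanskii's finiteness theorem — `OMinimalOfModelComplete.lean` with the normal form of
  `ETermReduction.lean` — rather than from the o-minimality of `ℝ_an`);
* `RealExpModel.eElementaryEmbedding`: **every embedding `k ↪ K` of models of `T_exp` is an
  elementary embedding `k | L_e ↪ₑ K | L_e`** (den Besten, p. 75: "`k ⪯ K` as `L_e`-structures").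

Nothing here is a named fact: the model completeness of `T_e` is an explicit hypothesis.

## References

* A. J. Wilkie, J. Amer. Math. Soc. 9 (1996), Theorem 11.1 (p. 1091), §1. [WilkieJAMS1996]
* M. den Besten, MSc thesis, Utrecht 2016, Corollary 4.1.7, Corollary 6.2.4, Theorem 7.2.1, p. 75.
  [DenBesten2016]
-/

noncomputable section

open FirstOrder FirstOrder.Language FirstOrder.Language.Structure
open scoped FirstOrder

namespace Literature.ModelTheory.ExponentialFields

namespace RealExpModel

open OMinimalOfModelComplete

/-- `L_e`-sentences transfer between any model of `T_exp` and `ℝ` presented as the bundled model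
`realModel` (both satisfy the complete theory `T_e`). [cite: DenBesten2016, Definition 6.2.2] -/
theorem realize_eSentence_iff_realModel (K : Language.Theory.ModelType.{0, 0, 0} realExpTheory)
    (σ : Language.orderedERing.Sentence) : (K : Type) ⊨ σ ↔ (realModel : Type) ⊨ σ :=
  (realize_eSentence_iff_real K σ).trans (realize_eSentence_iff_real realModel σ).symm

/-- **If `T_e` is model complete, then the `e`-reduct `K | L_e` of every model `K` of `T_exp` is
o-minimal** (Wilkie 1996, Theorem 11.1, via Khovanskii's finiteness theorem as in §1 of that
paper for `T_exp`; den Besten 2016, Corollary 4.1.7 and Proposition A.2.5 derive it from the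
o-minimality of `ℝ_an`).  The model completeness of `T_e` — the First Main Theorem for
`exp↾[0, 1]` — is the hypothesis `hMC`. [cite: WilkieJAMS1996, Theorem 11.1] -/
theorem isOMinimal_orderedERing_of_isModelComplete (hMC : eTheory.IsModelComplete)
    (K : Language.Theory.ModelType.{0, 0, 0} realExpTheory) :
    Language.orderedERing.IsOMinimal K :=
  isOMinimal_of_isModelComplete (T' := eTheory)
    (fun hψ => IsExpTermDefinable.of_isExistential_orderedERing hψ)
    realize_eSentence_iff_realModel hMC K

/-- In particular `(ℝ; +, ·, -, 0, 1, e, ≤)`, presented as the bundled model `realModel`, is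
o-minimal if `T_e` is model complete (Wilkie 1996, Theorem 11.1). [cite: WilkieJAMS1996, Theorem 11.1] -/
theorem isOMinimal_orderedERing_realModel_of_isModelComplete (hMC : eTheory.IsModelComplete) :
    Language.orderedERing.IsOMinimal realModel :=
  isOMinimal_orderedERing_of_isModelComplete hMC realModel

/-- **`(ℝ; +, ·, -, 0, 1, e, ≤)` itself (with its own structure, `Real.instEFun`) is o-minimal if
`T_e` is model complete** (Wilkie 1996, Theorem 11.1: `T_e` is an o-minimal theory; its standard
model). [cite: WilkieJAMS1996, Theorem 11.1] -/
theorem _root_.Literature.ModelTheory.ExponentialFields.Real.isOMinimal_orderedERing_of_isModelComplete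
    (hMC : eTheory.IsModelComplete) : Language.orderedERing.IsOMinimal ℝ :=
  isOMinimal_real_of_isModelComplete (T' := eTheory)
    (fun hψ => IsExpTermDefinable.of_isExistential_orderedERing hψ)
    (fun σ h => (realize_eSentence_iff_real realModel σ).1 h) hMC

/-! ### `k | L_e ≼ K | L_e` -/

/-- **If `T_e` is model complete, every embedding `f : k ↪ K` of models of `T_exp` is an
elementary map of the `e`-reducts**: `L_e`-formulas with parameters from `k` hold in `k | L_e`
iff they hold in `K | L_e` (den Besten 2016, proof of Theorem 6.1.2, p. 75: "`k ⪯ K` as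
`L_e`-structures"; Wilkie 1996, §11). [cite: DenBesten2016, Corollary 6.2.4] -/
theorem realize_orderedERing_comp_iff_of_isModelComplete (hMC : eTheory.IsModelComplete)
    {k K : Language.Theory.ModelType.{0, 0, 0} realExpTheory}
    (f : k ↪[Language.orderedExpRing] K) {n : ℕ} (φ : Language.orderedERing.Formula (Fin n))
    (x : Fin n → k) : φ.Realize (f ∘ x) ↔ φ.Realize x :=
  hMC (eModel k) (eModel K) (eEmbedding f) n φ x

/-- **The `e`-reduct of an embedding of models of `T_exp` as an elementary embedding of
`L_e`-structures**, granted the model completeness of `T_e` (den Besten 2016, Corollary 6.2.4 and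
p. 75). [cite: DenBesten2016, Corollary 6.2.4] -/
def eElementaryEmbedding (hMC : eTheory.IsModelComplete)
    {k K : Language.Theory.ModelType.{0, 0, 0} realExpTheory}
    (f : k ↪[Language.orderedExpRing] K) : k ↪ₑ[Language.orderedERing] K where
  toFun := f
  map_formula' := fun _ φ x => realize_orderedERing_comp_iff_of_isModelComplete hMC f φ x

/-- The underlying map of `eElementaryEmbedding hMC f` is `f`. [folklore] -/
@[simp]
theorem eElementaryEmbedding_apply (hMC : eTheory.IsModelComplete)
    {k K : Language.Theory.ModelType.{0, 0, 0} realExpTheory}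
    (f : k ↪[Language.orderedExpRing] K) (a : k) : eElementaryEmbedding hMC f a = f a :=
  rfl

end RealExpModel

end Literature.ModelTheory.ExponentialFields
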